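import Literature.MathematicalPhysics.QuantumFieldTheory.Federbush1986.DyadicSmoothing
import Literature.MathematicalPhysics.QuantumFieldTheory.Federbush1986.PhaseCellIVGeomConstruction4

/-!
# `Federbush1986.CubeCutoffs` — [Federbush1988PhaseCellIV] §11 Geometric Construction 5 (11.10)–(11.11) p. 338 / Theorem A.3
# (A.29)–(A.30) p. 342 ON THE UNIT `k`-CUBE: the coordinate size function `m(x) = min_i min(x_i, 1 − x_i)` and the PRODUCT dyadic
# cutoffs `Θ_j(x) = Π_i χ(2^jx_i − 1)χ(2^j(1 − x_i) − 1)` form a `DyadicSmoothing.CutoffSystem` on the cube — PROVED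

statement-level skeleton of published theorems with citation tags; proofs where landed; nothing here is a claim about the Yang–Mills mass gap

CITATION HEADER.  P. Federbush, *A phase cell approach to Yang–Mills theory. IV. The choice of variables*, Commun. Math.
Phys. **114** (1988) 317–343 [Federbush1988PhaseCellIV], §11 Geometric Construction 5 (11.10)–(11.11) p. 338 («`ᵉˢφ′` is a
smoothing of `ᵉφ′` … `|D^α ᵉˢφ′(x)| ≤ c_α (1/(d(x, ∂D))^{|α|−1}) Λ₁(ᵉφ′)`», `H = D` a hypercube) and Appendix A, Theorem A.3 with
its proof (A.27)–(A.31) p. 342 (renders f4-p022/f4-p026 of unit `lit-balaban-r19`, read as images).  Cell `lit-balaban`, Phase-2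
proof seat **r19 gen 11** (F4 fold owner); SKELETON row **F4.Def§11**, cell Geometric Construction 5 (decl
`PhaseCellIVGauge.GeomConstruction5`, typed p314251) — engine 2/3 of its proof (1/3 `DyadicSmoothing`, 3/3
`PhaseCellIVGeomConstruction5`).  Inputs BY NAME: `DyadicSmoothing.CutoffSystem` (r19 g11), `BallCutoffs`
(`exists_smoothTransition_bound`, p259125), `PhaseCellIVAppAStatements` (`unitCube`, `cubeBoundary`, p242861),
`PhaseCellIVGeomConstruction4` (`CubeBall.mem_cubeBoundary_iff`, p266275), Mathlib `Real.smoothTransition`,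
`norm_iteratedFDeriv_mul_le`, `ContinuousLinearMap.iteratedFDeriv_comp_right`.

WHAT IS PRINTED AND WHAT IS DONE HERE.  Print's proof of Theorem A.3 (stated for the ball, used in §11 for hypercubes:
Construction 5 is «a smoothing of `ᵉφ′`» on `H`) asks for «a function `d(x) ∈ C^∞` … `½ d(x, ∂B) ≤ d(x) ≤ d(x, ∂B)`» (A.29) and
mollifies at the variable scale `εd(x)` (A.30).  On a CUBE no function smooth up to the boundary is comparable to `d(x, ∂D)`
(corners), and a regularised distance (smooth inside, `|D^m d| ≲ d^{1−m}`) would be needed to run (A.30) literally.  The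
dyadically frozen realisation of (A.30) (`DyadicSmoothing`, after p04's `BallSmoothing`) needs much less: only `C^∞` cutoffs
`Θ_j` with `Θ_j = 0` where `d ≤ 2^{−j}`, `Θ_j = 1` where `d ≥ 2^{1−j}`, and `‖D^iΘ_j‖ ≤ P·2^{ji}` — and on the cube these are
supplied by PRODUCTS of one-dimensional cutoffs in the face coordinates: with `χ = Real.smoothTransition`,
`Θ_j(x) := Π_{i<k} χ(2^jx_i − 1)·χ(2^j(1 − x_i) − 1)`, which is `C^∞` on all of `ℝᵏ`, equals `1` iff every face distance is
`≥ 2^{1−j}` and vanishes as soon as one face distance is `≤ 2^{−j}`; each factor has `‖D^r‖ ≤ S·2^{jr}` (chain rule with the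
linear coordinate map), and this bound is stable under products (Leibniz: `Σ_a C(r,a) = 2^r`).  The size function is the
coordinate one, `m(x) = min_i min(x_i, 1 − x_i)` (`= d(x, ∂D)` inside the cube; only `d(x, ∂D) ≤ m(x)` is needed and proved),
continuous and `1`-Lipschitz but NOT smooth — it is never differentiated.

WHAT THIS MODULE PROVIDES (namespace `CubeCutoffs`, `k ≥ 1` via `[NeZero k]` where needed): defs with bodies `edge`, `msize`
(`m(x)`), `fac`, `Theta`, **`cubeSystem k : DyadicSmoothing.CutoffSystem k`** (domain `unitCube k`, size `msize`, cutoffs `Theta`);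
theorems `msize_le_apply`, `msize_le_one_sub`, `exists_msize_eq`, `msize_pos_iff`, `msize_le_half`, `msize_le_msize_add_dist`,
`lipschitzWith_msize`, `closedBall_subset_unitCube`, `norm_iteratedFDeriv_smoothTransition_comp_le`, `scale_mul`, `scale_prod`,
`exists_Theta_bound`, `Theta_eq_one`, `Theta_eq_zero`, `mem_interior_unitCube_iff`, `msize_pos_iff_mem_interior`,
`msize_nonpos_of_mem_cubeBoundary`, **`infDist_cubeBoundary_le_msize`**.  No `Prop`-valued definition, no named fact; axioms
standard.
-/

namespace Literature.MathematicalPhysics.QuantumFieldTheory.Federbush1986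

noncomputable section

open Metric Set Filter Function Real
open scoped ContDiff Topology NNReal

namespace CubeCutoffs

open LipschitzMollifier (Euc)
open PhaseCellIVAppA (unitCube cubeBoundary cubeBoundary_subset)
open PhaseCellIVAppA.CubeBall (mem_cubeBoundary_iff)
open DyadicSmoothing BallCutoffs

variable {k : ℕ}

/-! ## §1 The coordinate size function `m(x) = min_i min(x_i, 1 − x_i)` -/

/-- The distance of the `i`-th coordinate to the two faces `{x_i = 0}`, `{x_i = 1}`: `min(x_i, 1 − x_i)`.
[cite: Federbush1988PhaseCellIV, (11.11) p. 338; (A.29) p. 342] -/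
def edge (x : Euc k) (i : Fin k) : ℝ := min (x i) (1 - x i)

/-- `Fin k` is nonempty for `k ≠ 0`. [cite: Federbush1988PhaseCellIV, Appendix A p. 339] -/
theorem univ_nonempty [NeZero k] : (Finset.univ : Finset (Fin k)).Nonempty :=
  ⟨⟨0, Nat.pos_of_ne_zero (NeZero.ne k)⟩, Finset.mem_univ _⟩

/-- **The size function of the cube**, `m(x) = min_i min(x_i, 1 − x_i)` — our `d(x)` of (A.29)/(11.11) on the hypercube
(`= d(x, ∂D)` in the cube; continuous, `1`-Lipschitz, not smooth and never differentiated).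
[cite: Federbush1988PhaseCellIV, (11.11) p. 338; (A.29) p. 342] -/
def msize [NeZero k] (x : Euc k) : ℝ := Finset.univ.inf' univ_nonempty (edge x)

/-- `m(x) ≤ min(x_i, 1 − x_i)`. [cite: Federbush1988PhaseCellIV, (A.29) p. 342] -/
theorem msize_le_edge [NeZero k] (x : Euc k) (i : Fin k) : msize x ≤ edge x i :=
  Finset.inf'_le _ (Finset.mem_univ i)

/-- `m(x) ≤ x_i`. [cite: Federbush1988PhaseCellIV, (A.29) p. 342] -/
theorem msize_le_apply [NeZero k] (x : Euc k) (i : Fin k) : msize x ≤ x i :=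
  (msize_le_edge x i).trans (min_le_left _ _)

/-- `m(x) ≤ 1 − x_i`. [cite: Federbush1988PhaseCellIV, (A.29) p. 342] -/
theorem msize_le_one_sub [NeZero k] (x : Euc k) (i : Fin k) : msize x ≤ 1 - x i :=
  (msize_le_edge x i).trans (min_le_right _ _)

/-- The minimum is attained: `m(x) = min(x_i, 1 − x_i)` for some `i`. [cite: Federbush1988PhaseCellIV, (A.29) p. 342] -/
theorem exists_msize_eq [NeZero k] (x : Euc k) : ∃ i, msize x = edge x i := by
  obtain ⟨i, -, hi⟩ := Finset.exists_mem_eq_inf' univ_nonempty (edge x)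
  exact ⟨i, hi⟩

/-- `c ≤ m(x) ↔ c ≤ min(x_i, 1 − x_i)` for all `i`. [cite: Federbush1988PhaseCellIV, (A.29) p. 342] -/
theorem le_msize_iff [NeZero k] {x : Euc k} {c : ℝ} : c ≤ msize x ↔ ∀ i, c ≤ edge x i := by
  simp [msize, Finset.le_inf'_iff]

/-- `m(x) > 0` iff `x` lies in the open cube `(0, 1)ᵏ`. [cite: Federbush1988PhaseCellIV, (A.29) p. 342] -/
theorem msize_pos_iff [NeZero k] {x : Euc k} : 0 < msize x ↔ ∀ i, 0 < x i ∧ x i < 1 := by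
  simp [msize, Finset.lt_inf'_iff, edge, sub_pos]

/-- `m(x) ≤ ½` (so dyadic levels start at `j = 1`). [cite: Federbush1988PhaseCellIV, (A.29) p. 342] -/
theorem msize_le_half [NeZero k] (x : Euc k) : msize x ≤ 1 / 2 := by
  have h := msize_le_edge x ⟨0, Nat.pos_of_ne_zero (NeZero.ne k)⟩
  unfold edge at h
  rcases le_total (x ⟨0, Nat.pos_of_ne_zero (NeZero.ne k)⟩) (1 / 2) with h1 | h1
  · exact h.trans ((min_le_left _ _).trans h1)
  · exact h.trans ((min_le_right _ _).trans (by linarith))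

/-- A coordinate difference is bounded by the Euclidean distance. [cite: Federbush1988PhaseCellIV, Appendix A p. 339] -/
theorem abs_apply_sub_le_dist (x y : Euc k) (i : Fin k) : |x i - y i| ≤ dist x y := by
  rw [dist_eq_norm, ← Real.norm_eq_abs]
  have := PiLp.norm_apply_le (x - y) i
  simpa using this

/-- `m` is `1`-Lipschitz: `m(x) ≤ m(y) + |x − y|`. [cite: Federbush1988PhaseCellIV, (A.29) p. 342] -/
theorem msize_le_msize_add_dist [NeZero k] (x y : Euc k) : msize x ≤ msize y + dist x y := by
  obtain ⟨i, hi⟩ := exists_msize_eq y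
  have hc := abs_apply_sub_le_dist x y i
  rw [abs_le] at hc
  have h1 : x i ≤ y i + dist x y := by linarith
  have h2 : 1 - x i ≤ (1 - y i) + dist x y := by linarith
  calc msize x ≤ edge x i := msize_le_edge x i
    _ ≤ min (y i + dist x y) ((1 - y i) + dist x y) := min_le_min h1 h2
    _ = edge y i + dist x y := min_add_add_right _ _ _
    _ = msize y + dist x y := by rw [hi]

/-- `m` is `1`-Lipschitz. [cite: Federbush1988PhaseCellIV, (A.29) p. 342] -/
theorem lipschitzWith_msize [NeZero k] : LipschitzWith 1 (msize : Euc k → ℝ) :=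
  LipschitzWith.of_le_add msize_le_msize_add_dist

/-- `m` is continuous. [cite: Federbush1988PhaseCellIV, (A.29) p. 342] -/
theorem continuous_msize [NeZero k] : Continuous (msize : Euc k → ℝ) := lipschitzWith_msize.continuous

/-- Pinching: if `m(x₁) ≤ 0` then `m(y) ≤ 2|y − x₁|` for every `y`. [cite: Federbush1988PhaseCellIV, (A.29) p. 342] -/
theorem msize_le_two_mul_dist [NeZero k] {x₁ : Euc k} (hx₁ : msize x₁ ≤ 0) (y : Euc k) : msize y ≤ 2 * dist y x₁ := by
  have := msize_le_msize_add_dist y x₁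
  linarith [dist_nonneg (x := y) (y := x₁)]

/-- Locality: the ball of radius `m(x)/2` about a point of the open cube lies in the cube.
[cite: Federbush1988PhaseCellIV, (A.30) p. 342] -/
theorem closedBall_subset_unitCube [NeZero k] {x : Euc k} (hx : 0 < msize x) : closedBall x (msize x / 2) ⊆ unitCube k := by
  intro y hy i
  rw [mem_closedBall] at hy
  have hc := abs_apply_sub_le_dist y x i
  rw [abs_le] at hc
  have h1 := msize_le_apply x i
  have h2 := msize_le_one_sub x i
  constructor <;> linarith

/-! ## §2 One-dimensional cutoff factors and the product bound -/

/-- **Chain rule with a coordinate map.** For a continuous linear `L : ℝᵏ → ℝ` and `b ∈ ℝ`: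
`‖D^r(χ(L· + b))(x)‖ ≤ sup‖D^rχ‖ · ‖L‖^r` (`χ = smoothTransition`). [cite: Federbush1988PhaseCellIV, (A.27), (A.29) p. 342] -/
theorem norm_iteratedFDeriv_smoothTransition_comp_le {r : ℕ} {S : ℝ} (hS : ∀ t : ℝ, ‖iteratedFDeriv ℝ r smoothTransition t‖ ≤ S)
    (L : Euc k →L[ℝ] ℝ) (b : ℝ) (x : Euc k) :
    ‖iteratedFDeriv ℝ r (fun y : Euc k => smoothTransition (L y + b)) x‖ ≤ S * ‖L‖ ^ r := by
  have hfun : (fun y : Euc k => smoothTransition (L y + b)) = (fun s : ℝ => smoothTransition (s + b)) ∘ L := rfl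
  have hg : ContDiff ℝ r (fun s : ℝ => smoothTransition (s + b)) :=
    smoothTransition.contDiff.comp (contDiff_id.add contDiff_const)
  have hS0 : 0 ≤ S := (norm_nonneg _).trans (hS 0)
  rw [hfun, L.iteratedFDeriv_comp_right hg x le_rfl]
  calc ‖(iteratedFDeriv ℝ r (fun s : ℝ => smoothTransition (s + b)) (L x)).compContinuousLinearMap fun _ => L‖
      ≤ ‖iteratedFDeriv ℝ r (fun s : ℝ => smoothTransition (s + b)) (L x)‖ * ∏ _ : Fin r, ‖L‖ :=
        ContinuousMultilinearMap.norm_compContinuousLinearMap_le _ _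
    _ ≤ S * ‖L‖ ^ r := by
        rw [Finset.prod_const, Finset.card_univ, Fintype.card_fin, iteratedFDeriv_comp_add_right]
        exact mul_le_mul_of_nonneg_right (hS _) (by positivity)

/-- The coordinate functional `y ↦ a·y_i` has norm `≤ |a|`. [cite: Federbush1988PhaseCellIV, Appendix A p. 339] -/
theorem norm_smul_proj_le (a : ℝ) (i : Fin k) : ‖a • (EuclideanSpace.proj i : Euc k →L[ℝ] ℝ)‖ ≤ |a| := by
  have hproj : ‖(EuclideanSpace.proj i : Euc k →L[ℝ] ℝ)‖ ≤ 1 :=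
    ContinuousLinearMap.opNorm_le_bound _ zero_le_one fun y => by simpa using PiLp.norm_apply_le y i
  rw [norm_smul, Real.norm_eq_abs]
  exact mul_le_of_le_one_right (abs_nonneg a) hproj

/-- The lower face factor `χ(2^jx_i − 1)` has `‖D^r‖ ≤ S·(2^j)^r`. [cite: Federbush1988PhaseCellIV, (A.27), (A.29) p. 342] -/
theorem norm_iteratedFDeriv_lo_le {r : ℕ} {S : ℝ} (hS : ∀ t : ℝ, ‖iteratedFDeriv ℝ r smoothTransition t‖ ≤ S)
    (j : ℕ) (i : Fin k) (x : Euc k) :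
    ‖iteratedFDeriv ℝ r (fun y : Euc k => smoothTransition (2 ^ j * y i - 1)) x‖ ≤ S * ((2 : ℝ) ^ j) ^ r := by
  set L : Euc k →L[ℝ] ℝ := (2 : ℝ) ^ j • (EuclideanSpace.proj i : Euc k →L[ℝ] ℝ) with hL
  have hLy : ∀ y : Euc k, L y = 2 ^ j * y i := fun y => rfl
  have hfun : (fun y : Euc k => smoothTransition (2 ^ j * y i - 1)) = fun y => smoothTransition (L y + (-1)) := by
    ext y; rw [hLy, ← sub_eq_add_neg]
  have hS0 : 0 ≤ S := (norm_nonneg _).trans (hS 0)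
  rw [hfun]
  refine (norm_iteratedFDeriv_smoothTransition_comp_le hS L (-1) x).trans (mul_le_mul_of_nonneg_left ?_ hS0)
  refine pow_le_pow_left₀ (norm_nonneg _) ((norm_smul_proj_le _ i).trans (le_of_eq (abs_of_pos (by positivity)))) r

/-- The upper face factor `χ(2^j(1 − x_i) − 1)` has `‖D^r‖ ≤ S·(2^j)^r`. [cite: Federbush1988PhaseCellIV, (A.27), (A.29) p. 342] -/
theorem norm_iteratedFDeriv_hi_le {r : ℕ} {S : ℝ} (hS : ∀ t : ℝ, ‖iteratedFDeriv ℝ r smoothTransition t‖ ≤ S)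
    (j : ℕ) (i : Fin k) (x : Euc k) :
    ‖iteratedFDeriv ℝ r (fun y : Euc k => smoothTransition (2 ^ j * (1 - y i) - 1)) x‖ ≤ S * ((2 : ℝ) ^ j) ^ r := by
  set L : Euc k →L[ℝ] ℝ := (-(2 : ℝ) ^ j) • (EuclideanSpace.proj i : Euc k →L[ℝ] ℝ) with hL
  have hLy : ∀ y : Euc k, L y = -(2 : ℝ) ^ j * y i := fun y => rfl
  have hfun : (fun y : Euc k => smoothTransition (2 ^ j * (1 - y i) - 1)) = fun y => smoothTransition (L y + (2 ^ j - 1)) := by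
    ext y
    rw [hLy]
    congr 1
    ring
  have hS0 : 0 ≤ S := (norm_nonneg _).trans (hS 0)
  rw [hfun]
  refine (norm_iteratedFDeriv_smoothTransition_comp_le hS L _ x).trans (mul_le_mul_of_nonneg_left ?_ hS0)
  refine pow_le_pow_left₀ (norm_nonneg _) ((norm_smul_proj_le _ i).trans (le_of_eq ?_)) r
  rw [abs_neg, abs_of_pos (by positivity)]

/-- **Products preserve the scaling `‖D^r‖ ≲ c^r`.** If `‖D^rf(x)‖ ≤ A c^r` and `‖D^rg(x)‖ ≤ B c^r` for `r ≤ m`, then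
`‖D^r(fg)(x)‖ ≤ 2^m A B c^r` for `r ≤ m` (Leibniz, `Σ_a C(r,a) = 2^r`). [cite: Federbush1988PhaseCellIV, (A.26)/(A.29) p. 342] -/
theorem scale_mul {f g : Euc k → ℝ} (hf : ContDiff ℝ ∞ f) (hg : ContDiff ℝ ∞ g) {m : ℕ} {A B c : ℝ}
    (hB : 0 ≤ B) (hc : 0 ≤ c) {x : Euc k}
    (hfb : ∀ r ≤ m, ‖iteratedFDeriv ℝ r f x‖ ≤ A * c ^ r) (hgb : ∀ r ≤ m, ‖iteratedFDeriv ℝ r g x‖ ≤ B * c ^ r)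
    {r : ℕ} (hr : r ≤ m) : ‖iteratedFDeriv ℝ r (fun y => f y * g y) x‖ ≤ 2 ^ m * A * B * c ^ r := by
  have hA : 0 ≤ A := by
    have := (norm_nonneg _).trans (hfb 0 (Nat.zero_le m))
    simpa using this
  refine (norm_iteratedFDeriv_mul_le hf hg x (n := r) (mod_cast le_top)).trans ?_
  have hsum : ∑ a ∈ Finset.range (r + 1), (r.choose a : ℝ) = 2 ^ r := by
    rw [← Nat.cast_sum, Nat.sum_range_choose]; norm_num
  calc ∑ a ∈ Finset.range (r + 1), (r.choose a : ℝ) * ‖iteratedFDeriv ℝ a f x‖ * ‖iteratedFDeriv ℝ (r - a) g x‖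
      ≤ ∑ a ∈ Finset.range (r + 1), (r.choose a : ℝ) * (A * c ^ a) * (B * c ^ (r - a)) := by
        refine Finset.sum_le_sum fun a ha => ?_
        rw [Finset.mem_range] at ha
        have h1 := hfb a (by omega)
        have h2 := hgb (r - a) (by omega)
        exact mul_le_mul (mul_le_mul_of_nonneg_left h1 (by positivity)) h2 (norm_nonneg _) (by positivity)
    _ = ∑ a ∈ Finset.range (r + 1), (r.choose a : ℝ) * (A * B * c ^ r) := by
        refine Finset.sum_congr rfl fun a ha => ?_
        rw [Finset.mem_range] at ha
        have : c ^ a * c ^ (r - a) = c ^ r := by rw [← pow_add]; congr 1; omega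
        calc (r.choose a : ℝ) * (A * c ^ a) * (B * c ^ (r - a)) = (r.choose a : ℝ) * (A * B * (c ^ a * c ^ (r - a))) := by ring
          _ = (r.choose a : ℝ) * (A * B * c ^ r) := by rw [this]
    _ = 2 ^ r * (A * B * c ^ r) := by rw [← Finset.sum_mul, hsum]
    _ ≤ 2 ^ m * (A * B * c ^ r) := by
        have h2 : (2 : ℝ) ^ r ≤ 2 ^ m := pow_le_pow_right₀ (by norm_num) hr
        exact mul_le_mul_of_nonneg_right h2 (by positivity)
    _ = 2 ^ m * A * B * c ^ r := by ring

/-- **Finite products.** If every factor has `‖D^rf_l(x)‖ ≤ A c^r` (`r ≤ m`, `A ≥ 1`), then `‖D^r(Π_{l∈u} f_l)(x)‖ ≤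
(2^m A)^{|u|} c^r` (`r ≤ m`). [cite: Federbush1988PhaseCellIV, (A.26)/(A.29) p. 342] -/
theorem scale_prod {ι : Type*} [DecidableEq ι] (u : Finset ι) {f : ι → Euc k → ℝ} (hf : ∀ l, ContDiff ℝ ∞ (f l))
    {m : ℕ} {A c : ℝ} (hA : 1 ≤ A) (hc : 0 ≤ c) {x : Euc k}
    (hb : ∀ l ∈ u, ∀ r ≤ m, ‖iteratedFDeriv ℝ r (f l) x‖ ≤ A * c ^ r) :
    ∀ r ≤ m, ‖iteratedFDeriv ℝ r (fun y => ∏ l ∈ u, f l y) x‖ ≤ (2 ^ m * A) ^ u.card * c ^ r := by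
  induction u using Finset.induction_on with
  | empty =>
      intro r _
      simp only [Finset.prod_empty, Finset.card_empty, pow_zero, one_mul]
      rcases Nat.eq_zero_or_pos r with rfl | hr0
      · simp
      · rw [iteratedFDeriv_const_of_ne hr0.ne', Pi.zero_apply, norm_zero]
        positivity
  | insert a u ha ih =>
      intro r hr
      simp only [Finset.prod_insert ha, Finset.card_insert_of_notMem ha]
      have hb' : ∀ l ∈ u, ∀ r ≤ m, ‖iteratedFDeriv ℝ r (f l) x‖ ≤ A * c ^ r := fun l hl => hb l (Finset.mem_insert_of_mem hl)
      have key := scale_mul (hf a) (contDiff_prod fun l _ => hf l) (by positivity) hc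
        (hb a (Finset.mem_insert_self a u)) (ih hb') hr
      calc ‖iteratedFDeriv ℝ r (fun y => f a y * ∏ l ∈ u, f l y) x‖ ≤ 2 ^ m * A * (2 ^ m * A) ^ u.card * c ^ r := key
        _ = (2 ^ m * A) ^ (u.card + 1) * c ^ r := by rw [pow_succ]; ring

/-! ## §3 The product cutoffs `Θ_j` of the cube -/

/-- The one-coordinate factor `χ(2^jx_i − 1)·χ(2^j(1 − x_i) − 1)`: `= 1` iff `min(x_i, 1 − x_i) ≥ 2^{1−j}`, `= 0` if
`min(x_i, 1 − x_i) ≤ 2^{−j}`. [cite: Federbush1988PhaseCellIV, (A.29)–(A.30) p. 342; (11.11) p. 338] -/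
def fac (j : ℕ) (i : Fin k) (x : Euc k) : ℝ := smoothTransition (2 ^ j * x i - 1) * smoothTransition (2 ^ j * (1 - x i) - 1)

/-- **The cumulative cutoffs of the cube**, `Θ_j(x) = Π_i χ(2^jx_i − 1)χ(2^j(1 − x_i) − 1)`.
[cite: Federbush1988PhaseCellIV, (A.29)–(A.30) p. 342; (11.11) p. 338] -/
def Theta (j : ℕ) (x : Euc k) : ℝ := ∏ i, fac j i x

/-- The lower factor is `C^∞`. [cite: Federbush1988PhaseCellIV, (A.27) p. 342] -/
theorem contDiff_lo (j : ℕ) (i : Fin k) : ContDiff ℝ ∞ fun y : Euc k => smoothTransition (2 ^ j * y i - 1) :=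
  smoothTransition.contDiff.comp (by fun_prop)

/-- The upper factor is `C^∞`. [cite: Federbush1988PhaseCellIV, (A.27) p. 342] -/
theorem contDiff_hi (j : ℕ) (i : Fin k) : ContDiff ℝ ∞ fun y : Euc k => smoothTransition (2 ^ j * (1 - y i) - 1) :=
  smoothTransition.contDiff.comp (by fun_prop)

/-- `fac j i ∈ C^∞`. [cite: Federbush1988PhaseCellIV, (A.27) p. 342] -/
theorem contDiff_fac (j : ℕ) (i : Fin k) : ContDiff ℝ ∞ (fac j i : Euc k → ℝ) := (contDiff_lo j i).mul (contDiff_hi j i)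

/-- `Θ_j ∈ C^∞(ℝᵏ)`. [cite: Federbush1988PhaseCellIV, (A.29) p. 342] -/
theorem contDiff_Theta (j : ℕ) : ContDiff ℝ ∞ (Theta j : Euc k → ℝ) := contDiff_prod fun i _ => contDiff_fac j i

/-- `0 ≤ fac ≤ 1`. [cite: Federbush1988PhaseCellIV, (A.27) p. 342] -/
theorem fac_nonneg (j : ℕ) (i : Fin k) (x : Euc k) : 0 ≤ fac j i x :=
  mul_nonneg (smoothTransition.nonneg _) (smoothTransition.nonneg _)

/-- `fac ≤ 1`. [cite: Federbush1988PhaseCellIV, (A.27) p. 342] -/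
theorem fac_le_one (j : ℕ) (i : Fin k) (x : Euc k) : fac j i x ≤ 1 :=
  mul_le_one₀ (smoothTransition.le_one _) (smoothTransition.nonneg _) (smoothTransition.le_one _)

/-- `0 ≤ Θ_j`. [cite: Federbush1988PhaseCellIV, (A.27) p. 342] -/
theorem Theta_nonneg (j : ℕ) (x : Euc k) : 0 ≤ Theta j x := Finset.prod_nonneg fun i _ => fac_nonneg j i x

/-- `Θ_j ≤ 1`. [cite: Federbush1988PhaseCellIV, (A.27) p. 342] -/
theorem Theta_le_one (j : ℕ) (x : Euc k) : Theta j x ≤ 1 :=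
  Finset.prod_le_one (fun i _ => fac_nonneg j i x) fun i _ => fac_le_one j i x

/-- `Θ_j(x) = 1` where `2^jm(x) ≥ 2` (every face distance `≥ 2^{1−j}`). [cite: Federbush1988PhaseCellIV, (A.29)–(A.30) p. 342] -/
theorem Theta_eq_one [NeZero k] {j : ℕ} {x : Euc k} (h : 2 ≤ (2 : ℝ) ^ j * msize x) : Theta j x = 1 := by
  refine Finset.prod_eq_one fun i _ => ?_
  have h2 : (0 : ℝ) < 2 ^ j := by positivity
  have ha := msize_le_apply x i
  have hb := msize_le_one_sub x i
  have ha' : 2 ≤ (2 : ℝ) ^ j * x i := h.trans (mul_le_mul_of_nonneg_left ha h2.le)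
  have hb' : 2 ≤ (2 : ℝ) ^ j * (1 - x i) := h.trans (mul_le_mul_of_nonneg_left hb h2.le)
  rw [fac, smoothTransition.one_of_one_le (by linarith), smoothTransition.one_of_one_le (by linarith), mul_one]

/-- `Θ_j(x) = 0` where `2^jm(x) ≤ 1` (some face distance `≤ 2^{−j}`). [cite: Federbush1988PhaseCellIV, (A.29)–(A.30) p. 342] -/
theorem Theta_eq_zero [NeZero k] {j : ℕ} {x : Euc k} (h : (2 : ℝ) ^ j * msize x ≤ 1) : Theta j x = 0 := by
  obtain ⟨i, hi⟩ := exists_msize_eq x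
  refine Finset.prod_eq_zero (Finset.mem_univ i) ?_
  rw [hi, edge] at h
  rcases min_choice (x i) (1 - x i) with hm | hm <;> rw [hm] at h
  · rw [fac, smoothTransition.zero_of_nonpos (by linarith), zero_mul]
  · rw [fac, smoothTransition.zero_of_nonpos (by linarith : (2 : ℝ) ^ j * (1 - x i) - 1 ≤ 0), mul_zero]

/-- **Derivative bounds for the product cutoffs**: `∃ P ≥ 1`, `‖D^iΘ_j(x)‖ ≤ P·2^{ji}` for all `j`, `i ≤ m`, all `x ∈ ℝᵏ`.
[cite: Federbush1988PhaseCellIV, (A.26)/(A.29) p. 342; (11.11) p. 338] -/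
theorem exists_Theta_bound (m : ℕ) : ∃ P : ℝ, 1 ≤ P ∧ ∀ j i, i ≤ m → ∀ x : Euc k,
    ‖iteratedFDeriv ℝ i (Theta j : Euc k → ℝ) x‖ ≤ P * (2 : ℝ) ^ (j * i) := by
  obtain ⟨S, hS1, hS⟩ := exists_smoothTransition_bound m
  set A : ℝ := 2 ^ m * S * S with hA_def
  have hA1 : 1 ≤ A := by
    have h2 : (1 : ℝ) ≤ 2 ^ m := one_le_pow₀ (by norm_num)
    exact one_le_mul_of_one_le_of_one_le (one_le_mul_of_one_le_of_one_le h2 hS1) hS1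
  refine ⟨(2 ^ m * A) ^ k, one_le_pow₀ (one_le_mul_of_one_le_of_one_le (one_le_pow₀ (by norm_num)) hA1), fun j i hi x => ?_⟩
  have hfac : ∀ l ∈ (Finset.univ : Finset (Fin k)), ∀ r ≤ m, ‖iteratedFDeriv ℝ r (fac j l) x‖ ≤ A * ((2 : ℝ) ^ j) ^ r := by
    intro l _ r hr
    exact scale_mul (contDiff_lo j l) (contDiff_hi j l) (by linarith) (by positivity)
      (fun r' hr' => norm_iteratedFDeriv_lo_le (hS r' hr') j l x) (fun r' hr' => norm_iteratedFDeriv_hi_le (hS r' hr') j l x) hr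
  have key := scale_prod Finset.univ (contDiff_fac j) hA1 (by positivity) hfac i hi
  rw [Finset.card_univ, Fintype.card_fin, ← pow_mul] at key
  exact key

/-! ## §4 The cutoff system of the unit cube -/

/-- **The unit `k`-cube as a dyadic cutoff system** (`k ≥ 1`): domain `D = unitCube k`, size `m(x) = min_i min(x_i, 1 − x_i)`,
product cutoffs `Θ_j`.  Feeding it to `DyadicSmoothing` gives the smoothing `ᵉˢφ′` of Geometric Construction 5 with (11.10)
and the bounds (11.11) in terms of `m(x) ≥ d(x, ∂D)`. [cite: Federbush1988PhaseCellIV, Geometric Construction 5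
(11.10)–(11.11) p. 338; (A.29)–(A.30) p. 342] -/
def cubeSystem (k : ℕ) [NeZero k] : CutoffSystem k where
  D := unitCube k
  σ := msize
  Θ := Theta
  continuous_σ := continuous_msize
  σ_le_one x := (msize_le_half x).trans (by norm_num)
  pinch x₁ hx₁ y := msize_le_two_mul_dist hx₁ y
  locality x hx := closedBall_subset_unitCube hx
  contDiff_Θ := contDiff_Theta
  Θ_nonneg := Theta_nonneg
  Θ_le_one := Theta_le_one
  Θ_eq_zero j x h := Theta_eq_zero h
  Θ_eq_one j x h := Theta_eq_one h
  Θ_bound m := by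
    obtain ⟨P, hP1, hP⟩ := exists_Theta_bound (k := k) m
    exact ⟨P, hP1, fun j i hi x _ => hP j i hi x⟩

/-- The domain of `cubeSystem k` is the closed cube. [cite: Federbush1988PhaseCellIV, Appendix A p. 339] -/
@[simp] theorem cubeSystem_D (k : ℕ) [NeZero k] : (cubeSystem k).D = unitCube k := rfl

/-- The size function of `cubeSystem k` is `m`. [cite: Federbush1988PhaseCellIV, (A.29) p. 342] -/
@[simp] theorem cubeSystem_σ (k : ℕ) [NeZero k] : (cubeSystem k).σ = msize := rfl

/-! ## §5 The open cube, the boundary, and `d(x, ∂D) ≤ m(x)` -/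

/-- The interior of the unit cube is the open cube `(0, 1)ᵏ`. [cite: Federbush1988PhaseCellIV, Appendix A p. 339] -/
theorem mem_interior_unitCube_iff {x : Euc k} : x ∈ interior (unitCube k) ↔ ∀ i, x i ∈ Ioo (0 : ℝ) 1 := by
  have hcube : unitCube k = (WithLp.ofLp : Euc k → (Fin k → ℝ)) ⁻¹' (Set.univ.pi fun _ => Icc (0 : ℝ) 1) := by
    ext y
    simp only [unitCube, mem_setOf_eq, mem_preimage, mem_univ_pi]
  have hpre : interior (unitCube k) =
      (WithLp.ofLp : Euc k → (Fin k → ℝ)) ⁻¹' interior (Set.univ.pi fun _ : Fin k => Icc (0 : ℝ) 1) := by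
    rw [hcube]
    exact ((EuclideanSpace.equiv (Fin k) ℝ).toHomeomorph.preimage_interior _).symm
  rw [hpre, mem_preimage, interior_pi_set finite_univ, mem_univ_pi]
  simp only [interior_Icc]

/-- `m(x) > 0` iff `x` lies in the interior of the cube. [cite: Federbush1988PhaseCellIV, (A.29) p. 342] -/
theorem msize_pos_iff_mem_interior [NeZero k] {x : Euc k} : 0 < msize x ↔ x ∈ interior (unitCube k) := by
  rw [msize_pos_iff, mem_interior_unitCube_iff]
  simp only [mem_Ioo]

/-- The interior of the cube is the region `{m > 0}` of `cubeSystem k`. [cite: Federbush1988PhaseCellIV, (A.29) p. 342] -/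
theorem interior_unitCube_eq [NeZero k] : interior (unitCube k) = {x : Euc k | 0 < msize x} :=
  Set.ext fun _ => msize_pos_iff_mem_interior.symm

/-- On `∂D` the size function is `≤ 0` (in fact `= 0`). [cite: Federbush1988PhaseCellIV, (11.10) p. 338; (A.25) p. 342] -/
theorem msize_nonpos_of_mem_cubeBoundary [NeZero k] {x : Euc k} (hx : x ∈ cubeBoundary k) : msize x ≤ 0 := by
  by_contra h
  rw [not_le, msize_pos_iff_mem_interior] at h
  exact hx.2 h

/-- **`d(x, ∂D) ≤ m(x)` on the cube** (the point of `∂D` straight across the nearest face is at distance `m(x)`), so that bounds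
in `m(x)^{−(i−1)}` give the printed `d(x, ∂D)^{−(|α|−1)}`. [cite: Federbush1988PhaseCellIV, (11.11) p. 338; (A.26) p. 342] -/
theorem infDist_cubeBoundary_le_msize [NeZero k] {x : Euc k} (hx : x ∈ unitCube k) : infDist x (cubeBoundary k) ≤ msize x := by
  obtain ⟨i, hi⟩ := exists_msize_eq x
  have hxi := hx i
  -- the two candidate boundary points across the faces `x_i = 0` and `x_i = 1`
  have hcoord : ∀ (c : ℝ) (l : Fin k), (x + c • EuclideanSpace.single i (1 : ℝ)) l = x l + c * (if l = i then 1 else 0) := by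
    intro c l
    simp
  have hmem : ∀ c : ℝ, x i + c ∈ Icc (0 : ℝ) 1 → (x i + c = 0 ∨ x i + c = 1) →
      x + c • EuclideanSpace.single i (1 : ℝ) ∈ cubeBoundary k := by
    intro c hc hc01
    rw [mem_cubeBoundary_iff]
    refine ⟨fun l => ?_, ⟨i, ?_⟩⟩
    · rw [hcoord]
      by_cases hl : l = i
      · subst hl; simpa using hc
      · simpa [hl] using hx l
    · rw [hcoord]; simpa using hc01
  have hdist : ∀ c : ℝ, dist x (x + c • EuclideanSpace.single i (1 : ℝ)) = |c| := by
    intro c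
    rw [dist_eq_norm, sub_add_cancel_left, norm_neg, norm_smul, Real.norm_eq_abs, PiLp.norm_single, norm_one, mul_one]
  rw [hi, edge]
  rcases min_choice (x i) (1 - x i) with hm | hm <;> rw [hm]
  · -- across the face `x_i = 0`
    have h := infDist_le_dist_of_mem (x := x) (hmem (-x i) (by simp) (Or.inl (by ring)))
    rw [hdist, abs_neg, abs_of_nonneg hxi.1] at h
    exact h
  · -- across the face `x_i = 1`
    have h := infDist_le_dist_of_mem (x := x) (hmem (1 - x i) (by simp) (Or.inr (by ring)))
    rw [hdist, abs_of_nonneg (by linarith [hxi.2])] at h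
    exact h

end CubeCutoffs

end

end Literature.MathematicalPhysics.QuantumFieldTheory.Federbush1986
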